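import Summits.BirchSwinnertonDyer.BirchSwinnertonDyer.Theorems.ResidualThetaTransportAtTwoSignedMuSeedAtTwoPlusLayerZeroExact
import Literature.NumberTheory.EllipticCurves.BSDSelmerCMPConverseBSDTripleProofs
import Literature.NumberTheory.EllipticCurves.Rank1Residual.X1MainConjecture
import Literature.NumberTheory.EllipticCurves.Kobayashi2003.SignedSelmerModuleFiniteProofs
import Literature.NumberTheory.EllipticCurves.ModularCurve
import HarnessLib

/-!
# Conditional torsion for `stub_torsionCMTwo` — Kobayashi Thm 1.2 torsion half at `p = 2` for CM rank-0

Helper for crux `SignedMainConjectureCMTwo` (stmt-BirchSwinnertonDyer-20307), line `rankzero`.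

**Strategy**: For a CM curve `A/ℚ` with `analyticRank = 0`, `GoodSS A 2`, `a₂ = 0`:
1. From `analyticRank = 0` → `L(A,1) ≠ 0` (modularity)
2. CM + `L(A,1) ≠ 0` → `BSDTriple A` (Burungale-Flach)
3. `BSDTriple` → `ShaFinite` + `mordellWeilRank = 0` → `selmerCorank = 0` → `Finite (selmerGroupPInfty A 2)`
4. `Finite (selmerGroupPInfty A 2)` + control → `Finite (endInvariants ...)`
5. Finite endInvariants → `Module.IsTorsion (IwasawaAlgebra 2) D.X`

**Conditional on**: `bsdTriple_of_hasCM_of_L_one_ne_zero` (Burungale-Flach 2024) and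
`nonempty_modularParametrizationData` (modularity). The skeleton's composition supplies these via
`stub_publishedInputsCMTwo`. [Kobayashi2003] Thm. 1.2; [BurungaleFlach2024] Cor. 2; [GreenbergLNM1716] §§3-4.
-/

set_option autoImplicit false
set_option linter.dupNamespace false

noncomputable section

open scoped Classical

open WeierstrassCurve Literature.NumberTheory.EllipticCurves
  Literature.NumberTheory.EllipticCurves.Kobayashi2003
  Literature.NumberTheory.EllipticCurves.Rank1Residual ZpExtension
  Summit.BirchSwinnertonDyer.BirchSwinnertonDyer.Theorems

namespace Summit.BirchSwinnertonDyer.BirchSwinnertonDyer.Theorems.ThetaPartnerAtTwoSignedMainConjectureCMTwoTorsion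

/-- **(T2_A) Kobayashi Thm 1.2, torsion half, at `p = 2`, for CM curves of analytic rank `0`.**

For a CM elliptic curve `A/ℚ` with `analyticRank = 0`, good supersingular reduction at `2` with
`a₂ = 0`, and any cyclotomic `ℤ₂`-extension with topological generator, every signed Selmer dual
datum has torsion `X`: the endInvariants are finite (Kobayashi's control `Sel⁺_∞^γ` is a bijection
onto `Sel_{2^∞}(A/ℚ)` which is finite by BSD for CM curves at rank 0).

CONDITIONAL on `bsdTriple_of_hasCM_of_L_one_ne_zero` (Burungale-Flach 2024, hypothesis `hBF`) and
`nonempty_modularParametrizationData` (modularity, hypothesis `hmod`). The skeleton's composition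
`SignedMainConjectureCMTwo_of` supplies these via `stub_publishedInputsCMTwo`.

[cite: Kobayashi2003, Thm. 1.2 (p. 2; torsion clause)]
[cite: BurungaleFlach2024, Cor. 2 (arXiv p. 4)]
[cite: GreenbergLNM1716, §4 Lemmas 4.3-4.4] -/
theorem torsionCMTwo_of_bsdTriple_of_modularity
    (hBF : bsdTriple_of_hasCM_of_L_one_ne_zero)
    (hmod : ModularForms.nonempty_modularParametrizationData)
    (A : WeierstrassCurve ℚ) [A.IsElliptic] [A.IsGloballyMinimal]
    (hcm : A.HasCM) (hr : A.analyticRank = 0) (hss : GoodSS A 2) (ha : A.frobeniusTrace 2 = 0)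
    (κ : ZpExtension ℚ 2) (γ : Field.absoluteGaloisGroup ℚ) (hκ : κ.IsCyclotomic) (hγ : κ.IsTopGenerator γ)
    (D : SignedSelmerDualData A κ γ 1) : Module.IsTorsion (IwasawaAlgebra 2) D.X := by
  -- Step 1: analyticRank = 0 → L(A,1) ≠ 0
  have hL : A.entireLFunction 1 ≠ 0 :=
    Rank1Residual.entireLFunction_one_ne_zero_of_analyticRank_eq_zero hmod A hr
  -- Step 2: CM + L(A,1) ≠ 0 → BSDTriple
  have hBSD : A.BSDTriple := hBF A hcm hL
  -- Step 3: BSDTriple → ShaFinite and mordellWeilRank = analyticRank = 0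
  have hShaFin : Finite A.sha := hBSD.2.1
  have hMW : A.mordellWeilRank = 0 := by
    have h : A.analyticRank = A.mordellWeilRank := hBSD.1
    rw [hr] at h
    exact h.symm
  -- Step 4: ShaFinite → shaCorank = 0, and with mordellWeilRank = 0, selmerCorank = 0
  haveI : Finite A.sha := hShaFin
  have hShaCorank : A.shaCorank 2 = 0 := A.shaCorank_eq_zero_of_finite 2
  have hSelCorank : A.selmerCorank 2 = 0 := by
    rw [A.selmerCorank_eq_mordellWeilRank_add_holds 2, hMW, hShaCorank]
  -- Step 5: selmerCorank = 0 → Finite (selmerGroupPInfty A 2)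
  haveI hFinSel : Finite (A.selmerGroupPInfty 2) :=
    (finite_selmerGroupPInfty_iff_selmerCorank_eq_zero A 2).mpr hSelCorank
  -- Step 6: Use natCard_endInvariants_dvd to get Finite endInvariants
  obtain ⟨hFinEnd, -⟩ :=
    SignedMuAtTwo.LayerZero.natCard_endInvariants_dvd A hss ha hκ hγ hFinSel
  -- Step 7: Apply isTorsion_of_finite_endInvariants
  exact D.isTorsion_of_finite_endInvariants hγ hFinEnd

end Summit.BirchSwinnertonDyer.BirchSwinnertonDyer.Theorems.ThetaPartnerAtTwoSignedMainConjectureCMTwoTorsion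

end
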